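import Literature.NumberTheory.Automorphic.HermitianLatticeTreeDiagonal   -- ★ (T1-B) lattice calculus
import Literature.LinearAlgebra.Matrix.SmithNormalFormValuationRing       -- ★ `ValuationSubring.exists_sl_mul_diagonal_mul_sl` (Cartan decomposition)
import HarnessLib

/-!
# The tree of self-dual and `ϖ`-modular lattices — GRAM MATRICES AND FRAMES: unimodularity under `GL₂(𝒪)`-congruence, basis-independence of the two types,
# the Cartan frame `latt g = latt (P·diag(ϖ^a, ϖ^b))`, and the two types read in a frame (Jacobowitz 1962 §7–§8; Serre, *Trees*, II.1.1)

Topic `NumberTheory/Automorphic`; namespace `Literature.NumberTheory.Automorphic.HermitianLatticeTree`.  THEOREMS ONLY (no definition, no instance, no notation, no named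
fact, no `sorry`).  Part (T1-C) of the lattice-tree road.  Cell `pub/hodgecm-mathlib` (D-0151), crux H413 (stmt-HodgeConjecture-24833), line «N6nsGerm», the Euler–Poincaré road (R2) `stub_N6nsR2EP : RankOneEulerPoincareNonsplit` — a count-free proof of the ELLIPTIC relation (E) of ★ `Rogawski1990/RankOneEulerPoincareGlue` at every TAME non-split place, inert and ramified alike (A-p17 (g22) bytes (T1), co-hand A-p06 (g27) `F0/P3a/A-p06/g27/CENSUS-R2ram-RamifiedEulerPoincare.A-p06g27.md`, LEAD F0P3a-plan (g10) WORDS T9-6 ∕ T9-8).  HONEST LABEL: HC_CM is proved only modulo the printed citations until rung 0 closes; nothing printed is asserted here (elementary lattice algebra over a valuation ring).  Hypotheses: `σ` VALUATION-PRESERVING (`hσv`), `ϖ` a uniformizing element (`hϖ`), `H`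
unimodular (`hH : IsUnimodular₂ H`); the hermitian symmetry of `H` is not needed.

* §6 `formCongr_mul`, `mem_integer_map`, `isUnimodular₂_congr_iff`, **`isSelfDualLattice_latt_iff`**, **`isModularLattice_latt_iff`** (the types are basis-independent),
  `not_isModularLattice_of_isSelfDualLattice` (no lattice has both types — the `hdisj` of `latticeTreeColoring`).
* §7 `coe_zpowDiagGL_two`, **`exists_frame`** (DVR: every `latt g` is `latt (P·diag(ϖ^a, ϖ^b))` with `P ∈ GL₂(𝒪)`), `isUnimodular₂_formCongr_of_mem_glInt`, the Gram entries ∕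
  determinant in a frame and their valuations, `valuation_zpow_eq_one_iff`, `zpow_mul_le_one_of_le`, **`isSelfDualLattice_frame_iff`** (`a + b = 0` + entry bounds),
  **`isModularLattice_frame_iff`** (`a + b = 1` + entry bounds).

## References
* [Serre1980Trees] J.-P. Serre, *Trees* (1980), Ch. II §1.1 (the tree of `SL₂` over a local field: lattices, adjacency, distance from a base lattice).
* [Jacobowitz1962] R. Jacobowitz, *Hermitian forms over local fields*, Amer. J. Math. 84 (1962), §4, §7–§8 (unimodular and `𝔭`-modular hermitian lattices).
* [BruhatTits1972] F. Bruhat, J. Tits, *Groupes réductifs sur un corps local I*, Publ. IHÉS 41 (1972), §10 (the building of a rank-one group is a tree).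
* [Kottwitz1988] R. E. Kottwitz, *Tamagawa numbers*, Ann. of Math. 127 (1988), §2 (facets of the building and the Euler–Poincaré function).
-/

set_option autoImplicit false

noncomputable section

open scoped ValuativeRel Matrix MatrixGroups
open Matrix ValuativeRel

namespace Literature.NumberTheory.Automorphic.HermitianLatticeTree

variable {E : Type*} [Field E] [ValuativeRel E]

/-! ## §6 Gram matrices in a frame: unimodularity, the two types, change of basis -/

section Gram

variable (σ : E →+* E)

omit [ValuativeRel E] in
/-- Change of basis of a Gram matrix: `formCongr σ (g k) H = (σk)ᵀ · formCongr σ g H · k`. [cite: Jacobowitz1962, §4] -/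
theorem formCongr_mul (g k : GL (Fin 2) E) (H : Matrix (Fin 2) (Fin 2) E) :
    formCongr σ (g * k) H = ((k : Matrix (Fin 2) (Fin 2) E).map σ)ᵀ * formCongr σ g H * (k : Matrix (Fin 2) (Fin 2) E) := by
  simp only [formCongr, Units.val_mul, Matrix.map_mul, Matrix.transpose_mul, Matrix.mul_assoc]

variable (hσv : ∀ x : E, valuation E (σ x) = valuation E x)

include hσv in
/-- A valuation-preserving `σ` preserves integrality. [cite: Jacobowitz1962, §4] -/
theorem mem_integer_map (x : E) (hx : x ∈ 𝒪[E]) : σ x ∈ 𝒪[E] := by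
  rw [Valuation.mem_integer_iff] at hx ⊢
  rw [hσv]; exact hx

include hσv in
/-- CONGRUENCE BY `GL₂(𝒪)` PRESERVES UNIMODULARITY: `(σk)ᵀ X k` is unimodular iff `X` is (`k ∈ GL₂(𝒪)`). [cite: Jacobowitz1962, §4] -/
theorem isUnimodular₂_congr_iff (X : Matrix (Fin 2) (Fin 2) E) (k : GL (Fin 2) E) (hk : k ∈ glInt 2 E) :
    IsUnimodular₂ (((k : Matrix (Fin 2) (Fin 2) E).map σ)ᵀ * X * (k : Matrix (Fin 2) (Fin 2) E)) ↔ IsUnimodular₂ X := by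
  -- one direction for every `k ∈ GL₂(𝒪)`, then applied to `k⁻¹`
  have key : ∀ (Y : Matrix (Fin 2) (Fin 2) E) (m : GL (Fin 2) E), m ∈ glInt 2 E → IsUnimodular₂ Y →
      IsUnimodular₂ (((m : Matrix (Fin 2) (Fin 2) E).map σ)ᵀ * Y * (m : Matrix (Fin 2) (Fin 2) E)) := by
    intro Y m hm hY
    obtain ⟨hmi, -⟩ := (mem_glInt_iff m).1 hm
    refine ⟨fun i j => ?_, ?_⟩
    · simp only [Matrix.mul_apply, Matrix.transpose_apply, Matrix.map_apply]
      refine Subring.sum_mem _ fun a _ => Subring.mul_mem _ (Subring.sum_mem _ fun b _ => Subring.mul_mem _ ?_ (hY.1 b a)) (hmi a j)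
      exact mem_integer_map σ hσv _ (hmi b i)
    · rw [Matrix.det_mul, Matrix.det_mul, Matrix.det_transpose, map_mul, map_mul, ← RingHom.mapMatrix_apply, ← RingHom.map_det, hσv,
        valuation_det_eq_one_of_mem_glInt hm, hY.2, mul_one, mul_one]
  refine ⟨fun h => ?_, key X k hk⟩
  have h2 := key _ k⁻¹ (inv_mem hk) h
  have hk1 : (k : Matrix (Fin 2) (Fin 2) E) * ((k⁻¹ : GL (Fin 2) E) : Matrix (Fin 2) (Fin 2) E) = 1 := by
    rw [← Units.val_mul, mul_inv_cancel, Units.val_one]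
  have hk2 : (((k⁻¹ : GL (Fin 2) E) : Matrix (Fin 2) (Fin 2) E).map σ)ᵀ * ((k : Matrix (Fin 2) (Fin 2) E).map σ)ᵀ = 1 := by
    rw [← Matrix.transpose_mul, ← Matrix.map_mul, hk1, Matrix.map_one σ (map_zero σ) (map_one σ), Matrix.transpose_one]
  have e1 : (((k⁻¹ : GL (Fin 2) E) : Matrix (Fin 2) (Fin 2) E).map σ)ᵀ * ((((k : Matrix (Fin 2) (Fin 2) E).map σ)ᵀ * X * (k : Matrix (Fin 2) (Fin 2) E))) *
      ((k⁻¹ : GL (Fin 2) E) : Matrix (Fin 2) (Fin 2) E) = X := by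
    calc _ = ((((k⁻¹ : GL (Fin 2) E) : Matrix (Fin 2) (Fin 2) E).map σ)ᵀ * ((k : Matrix (Fin 2) (Fin 2) E).map σ)ᵀ) * X *
          ((k : Matrix (Fin 2) (Fin 2) E) * ((k⁻¹ : GL (Fin 2) E) : Matrix (Fin 2) (Fin 2) E)) := by simp only [Matrix.mul_assoc]
      _ = X := by rw [hk1, hk2, Matrix.one_mul, Matrix.mul_one]
  rwa [e1] at h2

include hσv in
/-- The type of a lattice is basis-independent: `latt g` is SELF-DUAL iff the Gram matrix of `g` is unimodular. [cite: Jacobowitz1962, §7] -/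
theorem isSelfDualLattice_latt_iff (H : Matrix (Fin 2) (Fin 2) E) (g : GL (Fin 2) E) :
    IsSelfDualLattice σ H (latt (g : Matrix (Fin 2) (Fin 2) E)) ↔ IsUnimodular₂ (formCongr σ g H) := by
  constructor
  · rintro ⟨g', hg', hu⟩
    have hk : g⁻¹ * g' ∈ glInt 2 E := (span_range_transpose_eq_iff g g').1 hg'
    have hgk : g' = g * (g⁻¹ * g') := by rw [mul_inv_cancel_left]
    rw [hgk, formCongr_mul] at hu
    exact (isUnimodular₂_congr_iff σ hσv _ _ hk).1 hu
  · intro hu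
    exact ⟨g, rfl, hu⟩

include hσv in
/-- The type of a lattice is basis-independent: `latt g` is `ϖ`-MODULAR iff `ϖ⁻¹ ·` the Gram matrix of `g` is unimodular. [cite: Jacobowitz1962, §8] -/
theorem isModularLattice_latt_iff (ϖ : E) (H : Matrix (Fin 2) (Fin 2) E) (g : GL (Fin 2) E) :
    IsModularLattice σ ϖ H (latt (g : Matrix (Fin 2) (Fin 2) E)) ↔ IsUnimodular₂ (ϖ⁻¹ • formCongr σ g H) := by
  constructor
  · rintro ⟨g', hg', hu⟩
    have hk : g⁻¹ * g' ∈ glInt 2 E := (span_range_transpose_eq_iff g g').1 hg'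
    have hgk : g' = g * (g⁻¹ * g') := by rw [mul_inv_cancel_left]
    rw [hgk, formCongr_mul, ← Matrix.smul_mul, ← Matrix.mul_smul] at hu
    exact (isUnimodular₂_congr_iff σ hσv _ _ hk).1 hu
  · intro hu
    exact ⟨g, rfl, hu⟩

variable {ϖ : E} (hϖ : IsUniformizingElement ϖ)

include hϖ hσv in
/-- A lattice is never both self-dual and `ϖ`-modular (the determinants of `G` and `ϖ⁻¹G` cannot both be units). [cite: Jacobowitz1962, §8] -/
theorem not_isModularLattice_of_isSelfDualLattice (H : Matrix (Fin 2) (Fin 2) E) {M : Submodule 𝒪[E] (Fin 2 → E)}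
    (h1 : IsSelfDualLattice σ H M) (h2 : IsModularLattice σ ϖ H M) : False := by
  obtain ⟨g, rfl, hu⟩ := h1
  have hu2 := (isModularLattice_latt_iff σ hσv ϖ H g).1 h2
  have hd2 := hu2.2
  rw [Matrix.det_smul, Fintype.card_fin, map_mul, map_pow, map_inv₀, hu.2, mul_one] at hd2
  have hpos : 0 < valuation E ϖ := (Valuation.pos_iff _).mpr hϖ.ne_zero
  have hgt : 1 < (valuation E ϖ)⁻¹ := (one_lt_inv₀ hpos).mpr hϖ.valuation_lt_one
  exact ne_of_gt (one_lt_pow₀ hgt two_ne_zero) hd2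

end Gram

/-! ## §7 Frames: every lattice is `latt (P·diag(ϖ^a, ϖ^b))` with `P ∈ GL₂(𝒪)`; Gram matrices in a frame -/

section Frames

variable (σ : E →+* E) (hσv : ∀ x : E, valuation E (σ x) = valuation E x) {ϖ : E} (hϖ : IsUniformizingElement ϖ)
  {H : Matrix (Fin 2) (Fin 2) E} (hH : IsUnimodular₂ H)

omit [ValuativeRel E] in
/-- `diag(ϖ^{c₀}, ϖ^{c₁})` as an element of `GL₂(E)` is ★ `zpowDiagGL`: its matrix in the `![·,·]` spelling. [cite: Serre1980Trees, II.1.1] -/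
theorem coe_zpowDiagGL_two (hϖ0 : ϖ ≠ 0) (a b : ℤ) :
    ((zpowDiagGL (n := 2) hϖ0 ![a, b] : GL (Fin 2) E) : Matrix (Fin 2) (Fin 2) E) = Matrix.diagonal ![ϖ ^ a, ϖ ^ b] := by
  rw [coe_zpowDiagGL]
  congr 1
  funext i
  fin_cases i <;> rfl

include hϖ in
/-- **CARTAN FRAME** (DVR): every lattice `latt g` is `latt (P·diag(ϖ^a, ϖ^b))` for some `P ∈ GL₂(𝒪)` and `a, b ∈ ℤ`
(★ `ValuationSubring.exists_sl_mul_diagonal_mul_sl` + ★ `exists_eq_zpow_mul_of_ne_zero`). [cite: Serre1980Trees, II.1.1] [cite: BruhatTits1972, §10] -/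
theorem exists_frame [IsDiscreteValuationRing 𝒪[E]] (g : GL (Fin 2) E) :
    ∃ P : GL (Fin 2) E, P ∈ glInt 2 E ∧ ∃ a b : ℤ, latt (g : Matrix (Fin 2) (Fin 2) E) = latt ((P : Matrix (Fin 2) (Fin 2) E) * Matrix.diagonal ![ϖ ^ a, ϖ ^ b]) := by
  classical
  set O : ValuationSubring E := (valuation E).valuationSubring with hO
  have hOmem : ∀ x : E, x ∈ O ↔ x ∈ 𝒪[E] := fun x => by rw [hO, Valuation.mem_valuationSubring_iff, Valuation.mem_integer_iff]
  obtain ⟨P, Q, d, hP1, hQ1, hg⟩ := O.exists_sl_mul_diagonal_mul_sl (g : Matrix (Fin 2) (Fin 2) E)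
  have hdetP : (P.map O.subtype).det = 1 := by rw [← RingHom.mapMatrix_apply, ← RingHom.map_det, hP1, map_one]
  have hdetQ : (Q.map O.subtype).det = 1 := by rw [← RingHom.mapMatrix_apply, ← RingHom.map_det, hQ1, map_one]
  -- the diagonal entries are non-zero
  have hd : ∀ i, d i ≠ 0 := by
    have hdet : (g : Matrix (Fin 2) (Fin 2) E).det = d 0 * d 1 := by
      rw [hg, Matrix.det_mul, Matrix.det_mul, hdetP, hdetQ, one_mul, mul_one, Matrix.det_diagonal, Fin.prod_univ_two]
    have hne : (g : Matrix (Fin 2) (Fin 2) E).det ≠ 0 := (Matrix.isUnits_det_units g).ne_zero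
    rw [hdet] at hne
    intro i; fin_cases i
    · exact left_ne_zero_of_mul hne
    · exact right_ne_zero_of_mul hne
  -- `d i = ϖ^{a i} · e i` with `|e i| = 1`
  have hdec : ∀ i, ∃ (a : ℤ) (e : E), valuation E e = 1 ∧ d i = ϖ ^ a * e := fun i => exists_eq_zpow_mul_of_ne_zero hϖ (hd i)
  choose a e he hde using hdec
  have he0 : ∀ i, e i ≠ 0 := fun i h => by have := he i; rw [h, map_zero] at this; exact zero_ne_one this
  -- the frame `P′ := P · diag(e)` and the right factor `Q`
  set Pm : Matrix (Fin 2) (Fin 2) E := P.map O.subtype * Matrix.diagonal e with hPm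
  have hPmdet : Pm.det = e 0 * e 1 := by rw [hPm, Matrix.det_mul, hdetP, one_mul, Matrix.det_diagonal, Fin.prod_univ_two]
  have hPmne : Pm.det ≠ 0 := by rw [hPmdet]; exact mul_ne_zero (he0 0) (he0 1)
  have hQne : (Q.map O.subtype).det ≠ 0 := by rw [hdetQ]; exact one_ne_zero
  set P' : GL (Fin 2) E := Matrix.GeneralLinearGroup.mkOfDetNeZero Pm hPmne with hP'
  set Q' : GL (Fin 2) E := Matrix.GeneralLinearGroup.mkOfDetNeZero (Q.map O.subtype) hQne with hQ'
  have hP'val : (P' : Matrix (Fin 2) (Fin 2) E) = Pm := rfl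
  have hQ'val : (Q' : Matrix (Fin 2) (Fin 2) E) = Q.map O.subtype := rfl
  have hP'int : P' ∈ glInt 2 E := by
    refine mem_glInt_of_isIntegralMatrix (fun i j => ?_) ?_
    · rw [hP'val, hPm, Matrix.mul_apply]
      refine Subring.sum_mem _ fun l _ => Subring.mul_mem _ ((hOmem _).1 (P i l).2) ?_
      rw [Matrix.diagonal_apply]
      split_ifs
      · exact (Valuation.mem_integer_iff _ _).2 (he l).le
      · exact Subring.zero_mem _
    · rw [hP'val, hPmdet, map_mul, he, he, mul_one]
  have hQ'int : Q' ∈ glInt 2 E := by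
    refine mem_glInt_of_isIntegralMatrix (fun i j => ?_) ?_
    · rw [hQ'val]; exact (hOmem _).1 (Q i j).2
    · rw [hQ'val, hdetQ, map_one]
  refine ⟨P', hP'int, a 0, a 1, ?_⟩
  -- `g = (P′ · diag(ϖ^a)) · Q′`
  have hdiag : Matrix.diagonal d = Matrix.diagonal e * Matrix.diagonal (fun i => ϖ ^ a i) := by
    rw [Matrix.diagonal_mul_diagonal]; congr 1; funext i; rw [hde i, mul_comm]
  have hvec : (fun i => ϖ ^ a i) = ![ϖ ^ a 0, ϖ ^ a 1] := by funext i; fin_cases i <;> rfl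
  have hgeq : g = (P' * zpowDiagGL (n := 2) hϖ.ne_zero a) * Q' := by
    apply Units.ext
    rw [Units.val_mul, Units.val_mul, hP'val, hQ'val, coe_zpowDiagGL, hPm, hg, hdiag]
    simp only [Matrix.mul_assoc]
  rw [hgeq, latt_mul_of_mem_glInt _ _ hQ'int, Units.val_mul, coe_zpowDiagGL, hvec]

include hσv hH in
/-- The Gram matrix of an INTEGRAL frame is unimodular. [cite: Jacobowitz1962, §7] -/
theorem isUnimodular₂_formCongr_of_mem_glInt (P : GL (Fin 2) E) (hP : P ∈ glInt 2 E) : IsUnimodular₂ (formCongr σ P H) := by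
  have h := (isUnimodular₂_congr_iff σ hσv H P hP).2 hH
  exact h

omit [ValuativeRel E] in
/-- Entries of the Gram matrix of `P·diag(ϖ^c)`: `σ(ϖ^{c_i}) · G_{ij} · ϖ^{c_j}` with `G` the Gram matrix of `P`. [cite: Jacobowitz1962, §7] -/
theorem formCongr_mul_zpowDiagGL_apply (P : GL (Fin 2) E) (hϖ0 : ϖ ≠ 0) (c : Fin 2 → ℤ) (i j : Fin 2) :
    formCongr σ (P * zpowDiagGL hϖ0 c) H i j = σ (ϖ ^ c i) * formCongr σ P H i j * ϖ ^ c j := by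
  rw [formCongr_mul, coe_zpowDiagGL, Matrix.diagonal_map (map_zero σ), Matrix.diagonal_transpose, Matrix.mul_diagonal, Matrix.diagonal_mul]

include hσv in
/-- Valuations of the entries of the Gram matrix of `P·diag(ϖ^c)`: `|ϖ|^{c_i + c_j} · |G_{ij}|`. [cite: Jacobowitz1962, §7] -/
theorem valuation_formCongr_mul_zpowDiagGL_apply (P : GL (Fin 2) E) (hϖ0 : ϖ ≠ 0) (c : Fin 2 → ℤ) (i j : Fin 2) :
    valuation E (formCongr σ (P * zpowDiagGL hϖ0 c) H i j) = valuation E ϖ ^ (c i + c j) * valuation E (formCongr σ P H i j) := by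
  rw [formCongr_mul_zpowDiagGL_apply, map_mul, map_mul, hσv, map_zpow₀, map_zpow₀, zpow_add₀ ((Valuation.ne_zero_iff _).2 hϖ0),
    mul_right_comm]

include hσv in
/-- Valuation of the determinant of the Gram matrix of `P·diag(ϖ^c)`: `|ϖ|^{2(c₀ + c₁)} · |det G|`. [cite: Jacobowitz1962, §7] -/
theorem valuation_det_formCongr_mul_zpowDiagGL (P : GL (Fin 2) E) (hϖ0 : ϖ ≠ 0) (c : Fin 2 → ℤ) :
    valuation E (formCongr σ (P * zpowDiagGL hϖ0 c) H).det = valuation E ϖ ^ (2 * (c 0 + c 1)) * valuation E (formCongr σ P H).det := by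
  have hD : ((zpowDiagGL (n := 2) hϖ0 c : GL (Fin 2) E) : Matrix (Fin 2) (Fin 2) E).det = ϖ ^ (c 0 + c 1) := by
    rw [coe_zpowDiagGL, Matrix.det_diagonal, Fin.prod_univ_two, zpow_add₀ hϖ0]
  rw [formCongr_mul, Matrix.det_mul, Matrix.det_mul, Matrix.det_transpose, ← RingHom.mapMatrix_apply, ← RingHom.map_det, hD, map_mul, map_mul, hσv,
    map_zpow₀]
  have hv0 : valuation E ϖ ≠ 0 := (Valuation.ne_zero_iff _).2 hϖ0
  rw [show (2 : ℤ) * (c 0 + c 1) = (c 0 + c 1) + (c 0 + c 1) by ring, zpow_add₀ hv0, mul_right_comm]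
  simp only [← map_zpow₀, ← map_mul, ← zpow_add₀ hϖ0]

include hϖ in
/-- `|ϖ|^n ≤ 1 ↔ 0 ≤ n` and `|ϖ|^n = 1 ↔ n = 0`. [cite: Serre1980Trees, II.1.1] -/
theorem valuation_zpow_eq_one_iff (n : ℤ) : valuation E ϖ ^ n = 1 ↔ n = 0 := by
  have hpos : 0 < valuation E ϖ := (Valuation.pos_iff _).mpr hϖ.ne_zero
  have hlt := hϖ.valuation_lt_one
  constructor
  · intro h
    have h1 := (zpow_le_one_iff_right_of_lt_one₀ hpos hlt).1 h.le
    have h2 := (one_le_zpow_iff_right_of_lt_one₀ hpos hlt).1 h.ge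
    omega
  · rintro rfl; rw [zpow_zero]

include hϖ in
/-- Monotonicity of the entry conditions: `|ϖ|^m x ≤ 1` and `m ≤ n` give `|ϖ|^n x ≤ 1`; `x ≤ 1` and `0 ≤ n` give `|ϖ|^n x ≤ 1`. [cite: Serre1980Trees, II.1.1] -/
theorem zpow_mul_le_one_of_le {x : ValueGroupWithZero E} {m n : ℤ} (h : valuation E ϖ ^ m * x ≤ 1 ∨ (x ≤ 1 ∧ 0 ≤ n)) (hmn : m ≤ n ∨ (x ≤ 1 ∧ 0 ≤ n)) :
    valuation E ϖ ^ n * x ≤ 1 := by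
  have hpos : 0 < valuation E ϖ := (Valuation.pos_iff _).mpr hϖ.ne_zero
  have hle1 := hϖ.valuation_le_one
  rcases hmn with hmn | ⟨hx, hn⟩
  · rcases h with h | ⟨hx, hn⟩
    · exact le_trans (mul_le_mul_of_nonneg_right (zpow_le_zpow_right_of_le_one₀ hpos hle1 hmn) zero_le) h
    · exact mul_le_one' ((zpow_le_one_iff_right_of_lt_one₀ hpos hϖ.valuation_lt_one).2 hn) hx
  · exact mul_le_one' ((zpow_le_one_iff_right_of_lt_one₀ hpos hϖ.valuation_lt_one).2 hn) hx

include hσv hϖ hH in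
/-- **SELF-DUALITY IN A FRAME**: for `P ∈ GL₂(𝒪)` with Gram matrix `G`, the lattice `latt (P·diag(ϖ^a, ϖ^b))` is self-dual iff `a + b = 0` and
`|ϖ|^{c_i + c_j} |G_{ij}| ≤ 1` for all `i, j` (`c = (a, b)`). [cite: Jacobowitz1962, §7] -/
theorem isSelfDualLattice_frame_iff (P : GL (Fin 2) E) (hP : P ∈ glInt 2 E) (a b : ℤ) :
    IsSelfDualLattice σ H (latt ((P : Matrix (Fin 2) (Fin 2) E) * Matrix.diagonal ![ϖ ^ a, ϖ ^ b])) ↔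
      a + b = 0 ∧ ∀ i j : Fin 2, valuation E ϖ ^ ((![a, b] : Fin 2 → ℤ) i + (![a, b] : Fin 2 → ℤ) j) * valuation E (formCongr σ P H i j) ≤ 1 := by
  rw [← coe_zpowDiagGL_two hϖ.ne_zero, ← Units.val_mul, isSelfDualLattice_latt_iff σ hσv, IsUnimodular₂]
  have hG := isUnimodular₂_formCongr_of_mem_glInt σ hσv hH P hP
  constructor
  · rintro ⟨hint, hdet⟩
    refine ⟨?_, fun i j => ?_⟩
    · rw [valuation_det_formCongr_mul_zpowDiagGL σ hσv, hG.2, mul_one, valuation_zpow_eq_one_iff hϖ] at hdet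
      simpa using (by omega : (![a, b] : Fin 2 → ℤ) 0 + (![a, b] : Fin 2 → ℤ) 1 = 0)
    · have h := (Valuation.mem_integer_iff _ _).1 (hint i j)
      rwa [valuation_formCongr_mul_zpowDiagGL_apply σ hσv] at h
  · rintro ⟨hab, hint⟩
    refine ⟨fun i j => ?_, ?_⟩
    · rw [Valuation.mem_integer_iff, valuation_formCongr_mul_zpowDiagGL_apply σ hσv]; exact hint i j
    · rw [valuation_det_formCongr_mul_zpowDiagGL σ hσv, hG.2, mul_one, valuation_zpow_eq_one_iff hϖ]
      simp only [Matrix.cons_val_zero, Matrix.cons_val_one]; omega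

include hσv hϖ hH in
/-- **`ϖ`-MODULARITY IN A FRAME**: `latt (P·diag(ϖ^a, ϖ^b))` is `ϖ`-modular iff `a + b = 1` and `|ϖ|^{c_i + c_j − 1} |G_{ij}| ≤ 1` for all `i, j`.
[cite: Jacobowitz1962, §8] -/
theorem isModularLattice_frame_iff (P : GL (Fin 2) E) (hP : P ∈ glInt 2 E) (a b : ℤ) :
    IsModularLattice σ ϖ H (latt ((P : Matrix (Fin 2) (Fin 2) E) * Matrix.diagonal ![ϖ ^ a, ϖ ^ b])) ↔
      a + b = 1 ∧ ∀ i j : Fin 2, valuation E ϖ ^ ((![a, b] : Fin 2 → ℤ) i + (![a, b] : Fin 2 → ℤ) j - 1) * valuation E (formCongr σ P H i j) ≤ 1 := by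
  rw [← coe_zpowDiagGL_two hϖ.ne_zero, ← Units.val_mul, isModularLattice_latt_iff σ hσv, IsUnimodular₂]
  have hG := isUnimodular₂_formCongr_of_mem_glInt σ hσv hH P hP
  have hϖv : valuation E ϖ ≠ 0 := (Valuation.ne_zero_iff _).2 hϖ.ne_zero
  have hentry : ∀ i j, valuation E ((ϖ⁻¹ • formCongr σ (P * zpowDiagGL (n := 2) hϖ.ne_zero ![a, b]) H) i j) =
      valuation E ϖ ^ ((![a, b] : Fin 2 → ℤ) i + (![a, b] : Fin 2 → ℤ) j - 1) * valuation E (formCongr σ P H i j) := by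
    intro i j
    rw [Matrix.smul_apply, smul_eq_mul, map_mul, valuation_formCongr_mul_zpowDiagGL_apply σ hσv, map_inv₀, zpow_sub_one₀ hϖv,
      mul_comm (valuation E ϖ ^ _) (valuation E ϖ)⁻¹, mul_assoc]
  have hdet : valuation E (ϖ⁻¹ • formCongr σ (P * zpowDiagGL (n := 2) hϖ.ne_zero ![a, b]) H).det =
      valuation E ϖ ^ (-(2 : ℤ) + 2 * ((![a, b] : Fin 2 → ℤ) 0 + (![a, b] : Fin 2 → ℤ) 1)) := by
    rw [Matrix.det_smul, Fintype.card_fin, map_mul, map_pow, map_inv₀, valuation_det_formCongr_mul_zpowDiagGL σ hσv, hG.2, mul_one,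
      inv_pow, ← zpow_natCast, ← _root_.zpow_neg, ← zpow_add₀ hϖv]
    norm_num
  constructor
  · rintro ⟨hint, hd⟩
    refine ⟨?_, fun i j => ?_⟩
    · rw [hdet, valuation_zpow_eq_one_iff hϖ] at hd
      simp only [Matrix.cons_val_zero, Matrix.cons_val_one] at hd; omega
    · have h := (Valuation.mem_integer_iff _ _).1 (hint i j)
      rwa [hentry] at h
  · rintro ⟨hab, hint⟩
    refine ⟨fun i j => ?_, ?_⟩
    · rw [Valuation.mem_integer_iff, hentry]; exact hint i j
    · rw [hdet, valuation_zpow_eq_one_iff hϖ]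
      simp only [Matrix.cons_val_zero, Matrix.cons_val_one]; omega

end Frames

end Literature.NumberTheory.Automorphic.HermitianLatticeTree

end
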